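import Mathlib.Topology.Algebra.Group.Basic
import Mathlib.Algebra.Group.Subgroup.Pointwise
import Mathlib.GroupTheory.QuotientGroup.Defs
import Literature.AlgebraicGeometry.Frobenioids.Categories
import Literature.AnabelianGeometry.AbsoluteAnabelian.ProfiniteTerminology
import Literature.AnabelianGeometry.SemiGraphs.PSCFundamentalGroup
import HarnessLib

/-!
# [IUTchI] §2 Complements on Tempered Coverings: Prop. 2.1 – Cor. 2.5 (kurims pp. 44–56)

Mochizuki, *Inter-universal Teichmüller theory I: construction of Hodge theaters*, kurims
manuscript (May 2020), §2, pp. 44–56 ([IUTchI] §2 pp.44-56) [claim: Mochizuki2012, status: disputed] (D-0012 claim key;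
series status DISPUTED — nothing here is asserted; every printed statement is a `Prop`-valued
PREDICATE on explicitly given group-theoretic data).

STATEMENTS-FIRST over an INTERFACE.  The objects of §2 — `Π^tp_𝔾 ↪ Π̂_𝔾` for a semi-graph of
anabelioids `𝔾` of pro-`Σ` PSC-type ([SemiAnbd] §3, [CombGC] Def. 1.1), the decomposition subgroups
`Π^tp_ℍ`, `Π̂_ℍ` of a connected sub-semi-graph `ℍ` (p. 44), and, for a hyperbolic curve `X` with
stable reduction over an MLF `k`, the groups `Π^tp_X ⊇ Δ^tp_X`, `Π̂_X ⊇ Δ̂_X`, `G_k`, the surjections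
`Δ^tp_X ↠ Π^tp_𝔾`, `Δ̂_X ↠ Π̂_𝔾`, inertia / decomposition groups (pp. 46–47) — are deep inputs owned
by other seats (abc-iut-L3-t2/t3, abc-iut-L4-t1).  Here they enter as the DATA structures
`TemperedGraphGroupData` and `StableCurveTemperedData` (TODO-merge; MERGE TARGET for the X-level
structure: `Literature.AnabelianGeometry.SemiGraphs.TemperedCurve` in
`SemiGraphs/TemperedAnabelian.lean` — the `Σ̂ = Primes`, universe-0 special case with
`PiTemp ↪ PiHat`, the augmentation to `G_{ℚ_p}`, `DeltaTemp`/`DeltaHat`, decomposition / inertia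
groups; the two must not drift); the predicates below say "Proposition 2.1 holds for `D`", never
"for every `D`" (false for arbitrary abstract data).

Vocabulary REUSED from the tree: commensurably / normally terminal subgroups =
`Literature.AnabelianGeometry.AbsoluteAnabelian.IsCommensurablyTerminal` / `IsNormallyTerminal`
([AbsAnab] Def 0.1 (iii); the implication `.isNormallyTerminal` is proved there), pro-`Σ` groups =
`Literature.AnabelianGeometry.SemiGraphs.IsProSigma` ([CombGC] Def 1.1 (ii), with its finiteness
guard), slimness = `Literature.AlgebraicGeometry.Frobenioids.IsSlimGroup` ([FrdI] §0).
Typed (one declaration per printed (sub-)item): Prop. 2.1 `ProfiniteConjugatesOfCompactSubgroups`; Prop. 2.2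
`CommensuratorsOfDecompositionSubgroups`; Remark 2.2.2 `TemperedNormallyTerminal`; Cor. 2.3
(i)–(vi) `Cor23i` … `Cor23vi`; Prop. 2.4 (i)–(iii) `Prop24i` … `Prop24iii`; Cor. 2.5
`Cor25Decomposition`, `Cor25Inertia`.

Rendering notes.  (1) `Π^tp ↪ Π̂` is an injective continuous homomorphism `ι` (the tempered
topology is NOT the subspace topology); containments "`⊆ Π^tp`" inside `Π̂` are written through `ι`.
(2) "Compact subgroup of `Π^tp`" = compact carrier for the tempered topology.  (3) Cor. 2.3 (iii):
the text defines `Π_{X,ℍ}` "so as to render the sequences exact" (the extension of `G_k` by the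
centre-free `Δ_{X,ℍ}` given by the outer action of (i)); inside `Π_X` it is realised by the
normaliser `N_{Π_X}(Δ_{X,ℍ})` (cf. (iv)) — typed so (`piTpXH`, `piHatXH`).  (4) Cor. 2.3 (vi)(b) is
an atom of the data (`cuspMeetsH`).  (5) Decomposition / inertia groups "associated to `x`" are
the conjugates of one representative (as in the proof of Cor. 2.5, p. 51).
Deliberately NOT here: Remarks 2.2.1, 2.4.1, 2.5.1, 2.5.2 (prose); Remark 2.5.3 (i) (T1) is
`IsGaloisCountable` in `ConventionsTemperoids.lean`; Remark 2.5.3 (i) (T2)–(T6), (ii) (E1)–(E9),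
(iii)–(vi) are errata for [SemiAnbd] Def. 2.3/3.1–3.9/Rmk 2.4.2/Prop. 3.2/Def. 3.5/Def. 5.1
((c^new), (d^new), (O1)–(O3)) and belong with those items (seats abc-iut-L3-t1/t2/t3; INBOX note);
Thm. 2.6 – Cor. 2.8 are in `DiscreteProfiniteConjugates.lean`.  No printed statement is strengthened.
-/

namespace Literature.IUT.HodgeTheaters

open Pointwise Topology Literature.AlgebraicGeometry.Frobenioids
open Literature.AnabelianGeometry.AbsoluteAnabelian (IsCommensurablyTerminal IsNormallyTerminal)
open Literature.AnabelianGeometry.SemiGraphs (IsProSigma)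

universe u

/-! ### The 𝔾-level data and Propositions 2.1, 2.2 (pp. 44–46) -/

/-- INTERFACE DATA (TODO-merge:abc-iut-L3-t2/t3), IUTchI §2 pp. 44–45: nonempty sets of primes
`Σ ⊆ Σ̂`; the tempered fundamental group `Π^tp_𝔾` of a semi-graph of anabelioids `𝔾` of
pro-`Σ` PSC-type and its pro-`Σ̂` fundamental group `Π̂_𝔾`, with "the natural injection
`Π^tp_𝔾 ↪ Π̂_𝔾` that we shall use to regard `Π^tp_𝔾` as a subgroup of `Π̂_𝔾`"; and, for a connected
sub-semi-graph `ℍ ⊆ 𝔾`, the decomposition subgroups `Π^tp_ℍ ⊆ Π^tp_𝔾`, `Π̂_ℍ ⊆ Π̂_𝔾` with the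
commutative diagram of inclusions (p. 44).  Pure data: no theorem about `𝔾` is built in.
([IUTchI] §2 pp.44-45) [claim: Mochizuki2012, status: disputed] -/
structure TemperedGraphGroupData : Type (u + 1) where
  /-- the nonempty sets of primes `Σ ⊆ Σ̂` -/
  Sigma : Set ℕ
  SigmaHat : Set ℕ
  sigma_subset : Sigma ⊆ SigmaHat
  sigma_nonempty : Sigma.Nonempty
  sigmaHat_prime : ∀ p ∈ SigmaHat, p.Prime
  /-- `Π^tp_𝔾` (a topological group) and `Π̂_𝔾` (profinite) -/
  Tp : Type u
  [tpGroup : Group Tp]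
  [tpTop : TopologicalSpace Tp]
  [tpTopGroup : IsTopologicalGroup Tp]
  Hat : Type u
  [hatGroup : Group Hat]
  [hatTop : TopologicalSpace Hat]
  [hatTopGroup : IsTopologicalGroup Hat]
  [hatCompact : CompactSpace Hat]
  /-- the natural (continuous) injection `Π^tp_𝔾 ↪ Π̂_𝔾` -/
  ι : Tp →* Hat
  ι_continuous : Continuous ι
  ι_injective : Function.Injective ι
  /-- `Π^tp_ℍ ⊆ Π^tp_𝔾`, `Π̂_ℍ ⊆ Π̂_𝔾`, with `Π^tp_ℍ ↪ Π̂_ℍ` (the commutative diagram of p. 44) -/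
  TpH : Subgroup Tp
  HatH : Subgroup Hat
  tpH_le : TpH.map ι ≤ HatH

namespace TemperedGraphGroupData

attribute [instance] tpGroup tpTop tpTopGroup hatGroup hatTop hatTopGroup hatCompact

variable (D : TemperedGraphGroupData.{u})

/-- **Proposition 2.1 (Profinite Conjugates of Nontrivial Compact Subgroups)**, p. 45, for the
data `D`: for every nontrivial compact subgroup `Λ ⊆ Π^tp_𝔾` and every `γ ∈ Π̂_𝔾` such that
`γ · Λ · γ⁻¹ ⊆ Π^tp_𝔾`, we have `γ ∈ Π^tp_𝔾`.  A predicate, not asserted.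
([IUTchI] Prop 2.1 p.45) [claim: Mochizuki2012, status: disputed] -/
@[mk_iff] structure ProfiniteConjugatesOfCompactSubgroups : Prop where
  /-- `γ Λ γ⁻¹ ⊆ Π^tp_𝔾` with `Λ` nontrivial compact forces `γ ∈ Π^tp_𝔾` -/
  mem_of_conj_le : ∀ Λ : Subgroup D.Tp, IsCompact (Λ : Set D.Tp) → Λ ≠ ⊥ →
    ∀ γ : D.Hat, (∀ l ∈ Λ, γ * D.ι l * γ⁻¹ ∈ D.ι.range) → γ ∈ D.ι.range

/-- **Proposition 2.2 (Commensurators of Decomposition Subgroups Associated to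
Sub-semi-graphs)**, p. 45, for the data `D`: `Π̂_ℍ` is commensurably terminal in `Π̂_𝔾`; `Π^tp_ℍ` is
commensurably terminal in `Π̂_𝔾`, hence also in `Π^tp_𝔾`; in particular `Π^tp_𝔾` is commensurably
terminal in `Π̂_𝔾`.  A predicate, not asserted. ([IUTchI] Prop 2.2 p.45) [claim: Mochizuki2012, status: disputed] -/
structure CommensuratorsOfDecompositionSubgroups : Prop where
  /-- `C_{Π̂_𝔾}(Π̂_ℍ) = Π̂_ℍ` -/
  hatH : IsCommensurablyTerminal D.HatH
  /-- `C_{Π̂_𝔾}(Π^tp_ℍ) = Π^tp_ℍ` -/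
  tpH_in_hat : IsCommensurablyTerminal (D.TpH.map D.ι)
  /-- `C_{Π^tp_𝔾}(Π^tp_ℍ) = Π^tp_ℍ` -/
  tpH_in_tp : IsCommensurablyTerminal D.TpH
  /-- `C_{Π̂_𝔾}(Π^tp_𝔾) = Π^tp_𝔾` -/
  tp_in_hat : IsCommensurablyTerminal D.ι.range

/-- **Remark 2.2.2**, p. 46, for the data `D`: when `Σ̂ = Primes`, `Π^tp_𝔾` is normally terminal
in `Π̂_𝔾` (a consequence of [André] Lemma 3.2.1 / [SemiAnbd] Lemma 6.1 (i); also of Prop. 2.2).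
A predicate, not asserted. ([IUTchI] Rmk 2.2.2 p.46) [claim: Mochizuki2012, status: disputed] -/
@[mk_iff] structure TemperedNormallyTerminal : Prop where
  /-- `N_{Π̂_𝔾}(Π^tp_𝔾) = Π^tp_𝔾` when `Σ̂ = Primes` -/
  normallyTerminal : D.SigmaHat = {p | p.Prime} → IsNormallyTerminal D.ι.range

/-- The "in particular" of Prop. 2.2 implies the normal terminality of Remark 2.2.2 (for any `Σ̂`).
([IUTchI] Rmk 2.2.2 p.46) [claim: Mochizuki2012, status: disputed] -/
theorem temperedNormallyTerminal_of_prop22 (h : D.CommensuratorsOfDecompositionSubgroups) :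
    D.TemperedNormallyTerminal :=
  ⟨fun _ => h.tp_in_hat.isNormallyTerminal⟩

end TemperedGraphGroupData

/-! ### The X-level data and Corollary 2.3, Proposition 2.4, Corollary 2.5 (pp. 46–51) -/

/-- INTERFACE DATA (TODO-merge:abc-iut-L4-t1 for `Π_X`, abc-iut-L3-t2/t3 for the special fibre),
IUTchI §2 pp. 46–47: `k` an MLF of residue characteristic `p`, `X` a hyperbolic curve over `k`
with stable reduction over `O_k`; the "`Σ̂`-tempered" quotient `Π^tp_X` of `π₁^tp(X)` and the
profinite `Π̂_X`, each with its surjection to `G_k` (kernels `Δ^tp_X`, `Δ̂_X`), the natural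
inclusion `Π^tp_X ↪ Π̂_X`; the pro-`Σ` semi-graph of anabelioids `𝔾` of the geometric special
fibre of the stable model with a `G_k`-stable connected sub-semi-graph `ℍ` (as
`TemperedGraphGroupData`) and the natural surjections `Δ^tp_X ↠ Π^tp_𝔾`, `Δ̂_X ↠ Π̂_𝔾`;
representative inertia groups `I_x ⊆ Δ^tp_X` of the cusps `x` and decomposition groups
`D_x ⊆ Π^tp_X` of the closed points or cusps `x` of `X`; and, for each cusp, the atom "the cusp
`ξ` of the stable model corresponding to `x` meets an irreducible component of the special fibre
contained in `ℍ`" (Cor. 2.3 (vi)(b)).  Pure data. ([IUTchI] §2 pp.46-47) [claim: Mochizuki2012, status: disputed] -/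
structure StableCurveTemperedData : Type (u + 1) where
  /-- the special-fibre data `(Σ ⊆ Σ̂, Π^tp_𝔾 ↪ Π̂_𝔾, ℍ)` -/
  graph : TemperedGraphGroupData.{u}
  /-- the residue characteristic `p` of `k` -/
  p : ℕ
  /-- `p ∉ Σ` (p. 47) -/
  p_notMem : p ∉ graph.Sigma
  /-- `Π^tp_X` (topological group), `Π̂_X` (profinite), `G_k` -/
  PiTp : Type u
  [piTpGroup : Group PiTp]
  [piTpTop : TopologicalSpace PiTp]
  [piTpTopGroup : IsTopologicalGroup PiTp]
  PiHat : Type u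
  [piHatGroup : Group PiHat]
  [piHatTop : TopologicalSpace PiHat]
  [piHatTopGroup : IsTopologicalGroup PiHat]
  [piHatCompact : CompactSpace PiHat]
  Gk : Type u
  [gkGroup : Group Gk]
  [gkTop : TopologicalSpace Gk]
  /-- the natural (continuous) inclusion `Π^tp_X ↪ Π̂_X` (p. 47) -/
  ιX : PiTp →* PiHat
  ιX_continuous : Continuous ιX
  ιX_injective : Function.Injective ιX
  /-- the surjections `Π^tp_X ↠ G_k`, `Π̂_X ↠ G_k`, compatible along `ιX` -/
  prTp : PiTp →* Gk
  prHat : PiHat →* Gk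
  prTp_surjective : Function.Surjective prTp
  prHat_comp : prHat.comp ιX = prTp
  /-- the natural surjections `Δ^tp_X ↠ Π^tp_𝔾`, `Δ̂_X ↠ Π̂_𝔾` (p. 47) -/
  ρTp : prTp.ker →* graph.Tp
  ρHat : prHat.ker →* graph.Hat
  ρTp_surjective : Function.Surjective ρTp
  ρHat_surjective : Function.Surjective ρHat
  /-- compatibility `Π^tp_𝔾 ↪ Π̂_𝔾` versus `Δ^tp_X ↪ Δ̂_X` -/
  ρ_comp : ∀ d : prTp.ker, graph.ι (ρTp d) = ρHat ⟨ιX d, by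
    rw [MonoidHom.mem_ker, ← MonoidHom.comp_apply, prHat_comp]; exact d.2⟩
  /-- the cusps `x` of `X`, a representative inertia group `I_x ⊆ Δ^tp_X` of each, and the atom
  (vi)(b) "the cusp of the stable model corresponding to `x` meets an irreducible component of the
  special fibre that is contained in `ℍ`" -/
  Cusp : Type u
  inertiaTp : Cusp → Subgroup prTp.ker
  cuspMeetsH : Cusp → Prop
  /-- the closed points or cusps of `X`, with a representative decomposition group `D_x ⊆ Π^tp_X` -/
  Pt : Type u
  decompTp : Pt → Subgroup PiTp

namespace StableCurveTemperedData

attribute [instance] piTpGroup piTpTop piTpTopGroup piHatGroup piHatTop piHatTopGroup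
  piHatCompact gkGroup gkTop

variable (D : StableCurveTemperedData.{u})

/-- `Δ^tp_X := Ker(Π^tp_X ↠ G_k)`. ([IUTchI] §2 p.46) [claim: Mochizuki2012, status: disputed] -/
abbrev DeltaTp : Subgroup D.PiTp := D.prTp.ker
/-- `Δ̂_X := Ker(Π̂_X ↠ G_k)`. ([IUTchI] §2 p.47) [claim: Mochizuki2012, status: disputed] -/
abbrev DeltaHat : Subgroup D.PiHat := D.prHat.ker
/-- The inclusion `Δ^tp_X ↪ Δ̂_X` induced by `Π^tp_X ↪ Π̂_X` (p. 47). ([IUTchI] §2 p.47) [claim: Mochizuki2012, status: disputed] -/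
def ιΔ : D.DeltaTp →* D.DeltaHat :=
  (D.ιX.comp D.DeltaTp.subtype).codRestrict D.DeltaHat fun d => by
    rw [MonoidHom.mem_ker, MonoidHom.comp_apply, ← MonoidHom.comp_apply, D.prHat_comp]
    exact d.2

/-- `Δ^tp_{X,ℍ} := Δ^tp_X ×_{Π^tp_𝔾} Π^tp_ℍ ⊆ Δ^tp_X` (Cor. 2.3 (i)). ([IUTchI] Cor 2.3(i) p.47) [claim: Mochizuki2012, status: disputed] -/
def deltaTpH : Subgroup D.DeltaTp := D.graph.TpH.comap D.ρTp
/-- `Δ̂_{X,ℍ} := Δ̂_X ×_{Π̂_𝔾} Π̂_ℍ ⊆ Δ̂_X` (Cor. 2.3 (i)). ([IUTchI] Cor 2.3(i) p.47) [claim: Mochizuki2012, status: disputed] -/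
def deltaHatH : Subgroup D.DeltaHat := D.graph.HatH.comap D.ρHat
/-- `Π^tp_{X,ℍ} ⊆ Π^tp_X`, typed as the normaliser of `Δ^tp_{X,ℍ}` in `Π^tp_X` (rendering note (3)).
([IUTchI] Cor 2.3(iii) p.47) [claim: Mochizuki2012, status: disputed] -/
def piTpXH : Subgroup D.PiTp :=
  Subgroup.normalizer ((D.deltaTpH.map D.DeltaTp.subtype : Subgroup D.PiTp) : Set D.PiTp)
/-- `Π̂_{X,ℍ} ⊆ Π̂_X`, typed as the normaliser of `Δ̂_{X,ℍ}` in `Π̂_X` (rendering note (3)).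
([IUTchI] Cor 2.3(iii) p.47) [claim: Mochizuki2012, status: disputed] -/
def piHatXH : Subgroup D.PiHat :=
  Subgroup.normalizer ((D.deltaHatH.map D.DeltaHat.subtype : Subgroup D.PiHat) : Set D.PiHat)

/-- **Corollary 2.3 (i)**, p. 47: `Δ^tp_{X,ℍ} ⊆ Δ^tp_X` and `Δ̂_{X,ℍ} ⊆ Δ̂_X` are commensurably
terminal.  [The "in particular" — the outer `G_k`-actions descend to `Δ_{X,ℍ}` — is not
separately typed.]  A predicate, not asserted. ([IUTchI] Cor 2.3(i) p.47) [claim: Mochizuki2012, status: disputed] -/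
@[mk_iff] structure Cor23i : Prop where
  /-- `Δ^tp_{X,ℍ}` is commensurably terminal in `Δ^tp_X` -/
  tp : IsCommensurablyTerminal D.deltaTpH
  /-- `Δ̂_{X,ℍ}` is commensurably terminal in `Δ̂_X` -/
  hat : IsCommensurablyTerminal D.deltaHatH

/-- **Corollary 2.3 (ii)**, p. 47: the closure of `Δ^tp_{X,ℍ} ⊆ Δ^tp_X ⊆ Δ̂_X` in `Δ̂_X` is
`Δ̂_{X,ℍ}`.  A predicate, not asserted. ([IUTchI] Cor 2.3(ii) p.47) [claim: Mochizuki2012, status: disputed] -/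
@[mk_iff] structure Cor23ii : Prop where
  /-- closure of `Δ^tp_{X,ℍ}` in `Δ̂_X` is `Δ̂_{X,ℍ}` -/
  closure_eq : (D.deltaTpH.map D.ιΔ).topologicalClosure = D.deltaHatH

/-- The hypothesis of Cor. 2.3 (iii): (a) `Σ̂` contains a prime `l ∉ Σ ∪ {p}`, or (b) `Σ̂ = Primes`.
([IUTchI] Cor 2.3(iii) p.47) [claim: Mochizuki2012, status: disputed] -/
@[mk_iff] structure Cor23Hyp : Prop where
  /-- (a) or (b) -/
  out : (∃ l ∈ D.graph.SigmaHat, l ∉ D.graph.Sigma ∧ l ≠ D.p) ∨ D.graph.SigmaHat = {q | q.Prime}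

/-- **Corollary 2.3 (iii)**, p. 47: under (a) or (b), `Δ̂_{X,ℍ}` is slim; and the outer
`G_k`-actions give exact sequences of centre-free topological groups
`1 → Δ^tp_{X,ℍ} → Π^tp_{X,ℍ} → G_k → 1`, `1 → Δ̂_{X,ℍ} → Π̂_{X,ℍ} → G_k → 1` [typed: with
`Π_{X,ℍ}` the normalisers, `Π_{X,ℍ} ∩ Δ_X = Δ_{X,ℍ}`, `Π_{X,ℍ} ↠ G_k`, and the centres are trivial].
A predicate, not asserted. ([IUTchI] Cor 2.3(iii) p.47) [claim: Mochizuki2012, status: disputed] -/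
@[mk_iff] structure Cor23iii : Prop where
  /-- `Δ̂_{X,ℍ}` is slim -/
  slim : D.Cor23Hyp → IsSlimGroup D.deltaHatH
  /-- exactness of `1 → Δ^tp_{X,ℍ} → Π^tp_{X,ℍ} → G_k → 1` -/
  exact_tp : D.Cor23Hyp → D.piTpXH ⊓ D.DeltaTp = D.deltaTpH.map D.DeltaTp.subtype ∧
    Function.Surjective (D.prTp.comp D.piTpXH.subtype)
  /-- exactness of `1 → Δ̂_{X,ℍ} → Π̂_{X,ℍ} → G_k → 1` -/
  exact_hat : D.Cor23Hyp → D.piHatXH ⊓ D.DeltaHat = D.deltaHatH.map D.DeltaHat.subtype ∧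
    Function.Surjective (D.prHat.comp D.piHatXH.subtype)
  /-- the groups in the sequences are centre-free -/
  center_eq_bot : D.Cor23Hyp → Subgroup.center D.deltaTpH = ⊥ ∧ Subgroup.center D.piTpXH = ⊥ ∧
    Subgroup.center D.deltaHatH = ⊥ ∧ Subgroup.center D.piHatXH = ⊥

/-- **Corollary 2.3 (iv)**, p. 47: under the hypothesis of (iii), the images of
`Π^tp_{X,ℍ} ↪ Π^tp_X`, `Π̂_{X,ℍ} ↪ Π̂_X` are commensurably terminal.  A predicate, not asserted.
([IUTchI] Cor 2.3(iv) p.47) [claim: Mochizuki2012, status: disputed] -/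
@[mk_iff] structure Cor23iv : Prop where
  /-- `Π^tp_{X,ℍ} ⊆ Π^tp_X` is commensurably terminal -/
  tp : D.Cor23Hyp → IsCommensurablyTerminal D.piTpXH
  /-- `Π̂_{X,ℍ} ⊆ Π̂_X` is commensurably terminal -/
  hat : D.Cor23Hyp → IsCommensurablyTerminal D.piHatXH

/-- **Corollary 2.3 (v)**, p. 48: `Δ̂_{X,ℍ} ∩ Δ^tp_X = Δ^tp_{X,ℍ}` inside `Δ̂_X`.  A predicate, not
asserted. ([IUTchI] Cor 2.3(v) p.48) [claim: Mochizuki2012, status: disputed] -/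
@[mk_iff] structure Cor23v : Prop where
  /-- `Δ̂_{X,ℍ} ∩ Δ^tp_X = Δ^tp_{X,ℍ}` -/
  inf_eq : D.deltaHatH ⊓ D.ιΔ.range = D.deltaTpH.map D.ιΔ

/-- **Corollary 2.3 (vi)**, p. 48: for a cusp `x` with inertia group `I_x ⊆ Δ^tp_X`
(resp. `⊆ Δ̂_X`): `I_x` lies in a `Δ^tp_X`- (resp. `Δ̂_X`-) conjugate of `Δ^tp_{X,ℍ}` (resp. `Δ̂_{X,ℍ}`)
if and only if the corresponding cusp of the stable model meets an irreducible component of the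
special fibre contained in `ℍ`.  A predicate, not asserted. ([IUTchI] Cor 2.3(vi) p.48) [claim: Mochizuki2012, status: disputed] -/
@[mk_iff] structure Cor23vi : Prop where
  /-- tempered version -/
  tp : ∀ x : D.Cusp, (∃ d : D.DeltaTp, D.inertiaTp x ≤ MulAut.conj d • D.deltaTpH) ↔ D.cuspMeetsH x
  /-- profinite version -/
  hat : ∀ x : D.Cusp,
    (∃ d : D.DeltaHat, (D.inertiaTp x).map D.ιΔ ≤ MulAut.conj d • D.deltaHatH) ↔ D.cuspMeetsH x

/-- **Proposition 2.4 (i) (Profinite Conjugates of Nontrivial Arithmetic Compact Subgroups)**,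
p. 50: for `Λ ⊆ Δ^tp_X` a nontrivial pro-`Σ` compact subgroup and `γ ∈ Π̂_X` with
`γ · Λ · γ⁻¹ ⊆ Δ^tp_X`, we have `γ ∈ Π^tp_X`.  A predicate, not asserted.
([IUTchI] Prop 2.4(i) p.50) [claim: Mochizuki2012, status: disputed] -/
@[mk_iff] structure Prop24i : Prop where
  /-- `γ Λ γ⁻¹ ⊆ Δ^tp_X` with `Λ` nontrivial pro-`Σ` compact forces `γ ∈ Π^tp_X` -/
  mem_of_conj_le : ∀ Λ : Subgroup D.DeltaTp, IsCompact (Λ : Set D.DeltaTp) → Λ ≠ ⊥ →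
    IsProSigma D.graph.Sigma Λ →
    ∀ γ : D.PiHat, (∀ l ∈ Λ, γ * D.ιX l * γ⁻¹ ∈ (D.DeltaTp.map D.ιX)) → γ ∈ D.ιX.range

/-- **Proposition 2.4 (ii)**, p. 50: suppose `Σ̂ = Primes`; for `Λ ⊆ Π^tp_X` a [nontrivial]
compact subgroup whose image in `G_k` is open and `γ ∈ Π̂_X` with `γ · Λ · γ⁻¹ ⊆ Π^tp_X`, we have
`γ ∈ Π^tp_X`.  A predicate, not asserted. ([IUTchI] Prop 2.4(ii) p.50) [claim: Mochizuki2012, status: disputed] -/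
@[mk_iff] structure Prop24ii : Prop where
  /-- `γ Λ γ⁻¹ ⊆ Π^tp_X` with `Λ` compact of open image in `G_k` forces `γ ∈ Π^tp_X` -/
  mem_of_conj_le : D.graph.SigmaHat = {q | q.Prime} →
    ∀ Λ : Subgroup D.PiTp, IsCompact (Λ : Set D.PiTp) → Λ ≠ ⊥ →
      IsOpen (Λ.map D.prTp : Set D.Gk) →
      ∀ γ : D.PiHat, (∀ l ∈ Λ, γ * D.ιX l * γ⁻¹ ∈ D.ιX.range) → γ ∈ D.ιX.range

/-- **Proposition 2.4 (iii)**, p. 50: `Δ^tp_X` (resp. `Π^tp_X`) is commensurably terminal in `Δ̂_X`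
(resp. `Π̂_X`).  A predicate, not asserted. ([IUTchI] Prop 2.4(iii) p.50) [claim: Mochizuki2012, status: disputed] -/
@[mk_iff] structure Prop24iii : Prop where
  /-- `Δ^tp_X` is commensurably terminal in `Δ̂_X` -/
  delta : IsCommensurablyTerminal D.ιΔ.range
  /-- `Π^tp_X` is commensurably terminal in `Π̂_X` -/
  pi : IsCommensurablyTerminal D.ιX.range

/-- **Corollary 2.5 (Profinite Conjugates of Tempered Decomposition Groups)**, p. 51, decomposition
part, for `Σ̂ = Primes`: a decomposition group in `Π̂_X` of a closed point or cusp [a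
`Π̂_X`-conjugate of some `D_x`] is contained in `Π^tp_X` iff it is a decomposition group in `Π^tp_X`
[a `Π^tp_X`-conjugate of some `D_{x'}`]; and a `Π̂_X`-conjugate of `Π^tp_X` contains a decomposition
group in `Π^tp_X` iff it equals `Π^tp_X`.  A predicate, not asserted. ([IUTchI] Cor 2.5 p.51) [claim: Mochizuki2012, status: disputed] -/
@[mk_iff] structure Cor25Decomposition : Prop where
  /-- contained in `Π^tp_X` iff a tempered decomposition group -/
  le_iff : D.graph.SigmaHat = {q | q.Prime} → ∀ (x : D.Pt) (γ : D.PiHat),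
    MulAut.conj γ • (D.decompTp x).map D.ιX ≤ D.ιX.range ↔
      ∃ (x' : D.Pt) (t : D.PiTp),
        MulAut.conj γ • (D.decompTp x).map D.ιX = (MulAut.conj t • D.decompTp x').map D.ιX
  /-- a conjugate of `Π^tp_X` containing a tempered decomposition group is `Π^tp_X` -/
  conj_eq_iff : D.graph.SigmaHat = {q | q.Prime} → ∀ γ : D.PiHat,
    (∃ (x : D.Pt) (t : D.PiTp), (MulAut.conj t • D.decompTp x).map D.ιX ≤
        MulAut.conj γ • D.ιX.range) ↔
      MulAut.conj γ • D.ιX.range = D.ιX.range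

/-- **Corollary 2.5**, p. 51, inertia part (the "resp." reading), for `Σ̂ = Primes`: an inertia
group in `Π̂_X` of a cusp is contained in `Π^tp_X` iff it is an inertia group in `Π^tp_X` of a cusp;
and a `Π̂_X`-conjugate of `Π^tp_X` contains an inertia group in `Π^tp_X` of a cusp iff it equals
`Π^tp_X`.  [By Remark 2.5.2 this is the only part applied in [IUTchII].]  A predicate, not
asserted. ([IUTchI] Cor 2.5 p.51) [claim: Mochizuki2012, status: disputed] -/
@[mk_iff] structure Cor25Inertia : Prop where
  /-- contained in `Π^tp_X` iff a tempered cuspidal inertia group -/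
  le_iff : D.graph.SigmaHat = {q | q.Prime} → ∀ (x : D.Cusp) (γ : D.PiHat),
    MulAut.conj γ • ((D.inertiaTp x).map D.DeltaTp.subtype).map D.ιX ≤ D.ιX.range ↔
      ∃ (x' : D.Cusp) (t : D.PiTp),
        MulAut.conj γ • ((D.inertiaTp x).map D.DeltaTp.subtype).map D.ιX =
          (MulAut.conj t • (D.inertiaTp x').map D.DeltaTp.subtype).map D.ιX
  /-- a conjugate of `Π^tp_X` containing a tempered cuspidal inertia group is `Π^tp_X` -/
  conj_eq_iff : D.graph.SigmaHat = {q | q.Prime} → ∀ γ : D.PiHat,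
    (∃ (x : D.Cusp) (t : D.PiTp),
      (MulAut.conj t • (D.inertiaTp x).map D.DeltaTp.subtype).map D.ιX ≤
        MulAut.conj γ • D.ιX.range) ↔
      MulAut.conj γ • D.ιX.range = D.ιX.range

end StableCurveTemperedData

end Literature.IUT.HodgeTheaters
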